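import Literature.Barriers.AtomisticToContinuum.HalfFillingThermalKLS
import Literature.MathematicalPhysics.QuantumLattice.XYOrderDischarges
import HarnessLib

/-!
# Hard-core lattice bosons at half filling: discharges of (Cᵀ), (Sᵀ), (Tᵀ)

`Literature/Barriers/AtomisticToContinuum`; sibling proof file of `HalfFillingThermalKLS.lean`
(item `provefact-Literature.Barriers.AtomisticToContinuum.HalfFillingReflectionPositivity`). No statement
is introduced or changed; this file discharges the three state-independent / elementary facts
of the thermal KLS architecture for the Gibbs state of `hardCoreLatticeGas d L λ`
([LSSY2005] (11.2)):

* `hc_sumRule_holds : hc_sumRule` — fact (Cᵀ), the finite-volume sum rule [KLS1988PRL] (3), (6):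
  it is the tree's Fourier identity `Literature.MathematicalPhysics.QuantumLattice.sum_structureFactor_mul_cos` (any symmetric
  kernel) applied to the thermal two-point function, which is symmetric because the Gibbs state
  is Hermitian (`Matrix.gibbsState_conjTranspose`) and `(S_xS_y)ᴴ = S_yS_x`;
* `hc_corr_one_eq_zero_holds : hc_corr_one_eq_zero` — fact (Sᵀ), `⟨S²_xS²_y⟩_β = ⟨S¹_xS¹_y⟩_β`:
  the global quarter turn about the 3-axis (`XYOrderDischarges`: `quarterTurn_conj_*`) fixes
  `xyTorus` and every `S³_x`, hence the staggered field and `hardCoreLatticeGas`; Gibbs states are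
  invariant under unitaries commuting with `H` (`Matrix.gibbsState_conj_of_commute`);
* `hc_corr_abs_le_holds : hc_corr_abs_le` — fact (Tᵀ), `|⟨Sᵅ_xSᵅ_y⟩_β| ≤ ¼`: the Löwner bounds
  `¼ ± Sᵅ_xSᵅ_y ≥ 0` of `XYOrderDischarges` and positivity/normalisation of Gibbs states.

## References

* [LSSY2005] E. H. Lieb, R. Seiringer, J. P. Solovej, J. Yngvason, *The Mathematics of the Bose
  Gas and its Condensation* (2005), Ch. 11, (11.2) and §11.1 ("invariant under simultaneous
  rotations of all the spins around the 3-axis").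
* [KLS1988PRL] T. Kennedy, E. H. Lieb, B. S. Shastry, Phys. Rev. Lett. 61 (1988) 2582, eqs. (3),
  (6).
-/

noncomputable section

open Filter Topology Matrix Finset
open Literature.MathematicalPhysics.QuantumLattice Literature.Probability.LatticeModels Literature.Probability.Percolation
open scoped ComplexOrder

/-! ### Gibbs states: invariance under symmetries -/

namespace Matrix

variable {m : Type*} [Fintype m] [DecidableEq m]

/-- **Invariance of the Gibbs state under a symmetry**: if `U` commutes with `H` and `UᴴU = 1`
then `⟨U A Uᴴ⟩_β = ⟨A⟩_β` (`e^{-βH}` commutes with `U`, cyclicity of the trace).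
Bratteli–Robinson II §5.3.1. [folklore] -/
theorem gibbsState_conj_of_commute {H U : Matrix m m ℂ} (hU : U * H = H * U)
    (hUU : Uᴴ * U = 1) (β : ℝ) (A : Matrix m m ℂ) :
    gibbsState β H (U * A * Uᴴ) = gibbsState β H A := by
  have hc : Commute (gibbsWeight β H) U := by
    have h1 : Commute (-(β : ℂ) • H) U := (Commute.smul_left (a := H) (b := U) hU.symm _)
    exact h1.exp_left
  rw [gibbsState_apply, gibbsState_apply]
  congr 1
  calc (gibbsWeight β H * (U * A * Uᴴ)).trace = (U * (gibbsWeight β H * A) * Uᴴ).trace := by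
        rw [← Matrix.mul_assoc, ← Matrix.mul_assoc, hc.eq, Matrix.mul_assoc U]
    _ = (Uᴴ * U * (gibbsWeight β H * A)).trace := by
        rw [trace_mul_cycle, Matrix.mul_assoc]
    _ = (gibbsWeight β H * A).trace := by rw [hUU, Matrix.one_mul]

end Matrix

namespace Literature.Barriers.AtomisticToContinuum.BoseGas

variable {d : ℕ}

/-! ### The Hamiltonian: Hermiticity and the quarter-turn symmetry -/

/-- The staggered-field term `F = Σ_x (½ + (-1)^x S³_x)`. Local abbreviation of this file.
[cite: LSSY2005, Ch. 11 (11.2)] -/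
theorem hardCoreLatticeGas_eq (d L : ℕ) [NeZero L] (lam : ℝ) :
    hardCoreLatticeGas d L lam = xyTorus d L 1 + (lam : ℂ) • ∑ x : TorusSite d L,
      ((1 / 2 : ℂ) • (1 : Op (TorusSite d L) 2) + ((-1 : ℂ) ^ (∑ i, (x i).val)) • siteSpin 1 x 2) :=
  rfl

/-- The staggered-field term is Hermitian (real coefficients, Hermitian `S³`). [folklore] -/
theorem staggeredField_isHermitian (d L : ℕ) [NeZero L] :
    (∑ x : TorusSite d L, ((1 / 2 : ℂ) • (1 : Op (TorusSite d L) 2) +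
      ((-1 : ℂ) ^ (∑ i, (x i).val)) • siteSpin 1 x 2)).IsHermitian := by
  refine (isSelfAdjoint_sum _ fun x _ => ?_).isHermitian
  refine IsHermitian.isSelfAdjoint (IsHermitian.add ?_ ?_)
  · refine IsHermitian.smul isHermitian_one ?_
    rw [isSelfAdjoint_iff]; norm_num [Complex.ext_iff]
  · refine IsHermitian.smul (siteSpin_isHermitian 1 x 2) ?_
    rw [isSelfAdjoint_iff, star_pow]; norm_num

/-- `hardCoreLatticeGas` is Hermitian. [cite: LSSY2005, Ch. 11 (11.2)] -/
theorem hardCoreLatticeGas_isHermitian (d L : ℕ) [NeZero L] (lam : ℝ) :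
    (hardCoreLatticeGas d L lam).IsHermitian := by
  rw [hardCoreLatticeGas_eq]
  refine (xyTorus_isHermitian d L 1).add (IsHermitian.smul (staggeredField_isHermitian d L) ?_)
  rw [isSelfAdjoint_iff, Complex.star_def, Complex.conj_ofReal]

/-- **`U(1)` symmetry of the hard-core lattice gas**: the global quarter turn about the 3-axis
fixes `hardCoreLatticeGas` (it fixes `xyTorus` and every `S³_x`, hence the staggered field).
[LSSY2005, Ch. 11 §11.1] [cite: LSSY2005, Ch. 11 §11.1] -/
theorem quarterTurn_conj_hardCoreLatticeGas (d L : ℕ) [NeZero L] (lam : ℝ) :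
    productOp (fun _ : TorusSite d L => diagonal fun k : Fin 2 => (-Complex.I) ^ (k : ℕ)) *
        hardCoreLatticeGas d L lam *
        (productOp (fun _ : TorusSite d L => diagonal fun k : Fin 2 => (-Complex.I) ^ (k : ℕ)))ᴴ =
      hardCoreLatticeGas d L lam := by
  set U : Op (TorusSite d L) 2 :=
    productOp (fun _ : TorusSite d L => diagonal fun k : Fin 2 => (-Complex.I) ^ (k : ℕ)) with hU
  have hUU' : U * Uᴴ = 1 := productOp_mul_conjTranspose fun _ => spinPhase_mul_conjTranspose 1
  have hXY : U * xyTorus d L 1 * Uᴴ = xyTorus d L 1 :=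
    quarterTurn_conj_xxzHamiltonian 1 (torusGraph d L) (-1) 0
  have hS3 : ∀ x : TorusSite d L, U * siteSpin 1 x 2 * Uᴴ = siteSpin 1 x 2 :=
    fun x => quarterTurn_conj_siteSpin_two 1 x
  rw [hardCoreLatticeGas_eq, Matrix.mul_add, Matrix.add_mul, hXY, Matrix.mul_smul,
    Matrix.smul_mul, Finset.mul_sum, Finset.sum_mul]
  congr 2
  refine sum_congr rfl fun x _ => ?_
  rw [Matrix.mul_add, Matrix.add_mul, Matrix.mul_smul, Matrix.smul_mul, Matrix.mul_smul,
    Matrix.smul_mul, Matrix.mul_one, hUU', hS3]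

/-! ### (Sᵀ) `⟨S²_x S²_y⟩ = ⟨S¹_x S¹_y⟩` -/

/-- **Discharge of (Sᵀ)** `hc_corr_one_eq_zero`: `⟨S²_xS²_y⟩_β = ⟨S¹_xS¹_y⟩_β` in the Gibbs
state of the hard-core lattice gas, by invariance under the global quarter turn about the
3-axis (`U S² Uᴴ = S¹`). [cite: LSSY2005, Ch. 11 §11.1] -/
theorem hc_corr_one_eq_zero_holds : hc_corr_one_eq_zero := by
  intro d L β lam x y
  rcases Nat.eq_zero_or_pos L with rfl | hL
  · simp
  haveI : NeZero L := ⟨hL.ne'⟩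
  rw [hcCorr_of_neZero, hcCorr_of_neZero, thermalCorr, thermalCorr]
  set U : Op (TorusSite d L) 2 :=
    productOp (fun _ : TorusSite d L => diagonal fun k : Fin 2 => (-Complex.I) ^ (k : ℕ))
    with hU
  have hUU : Uᴴ * U = 1 := productOp_conjTranspose_mul fun _ => spinPhase_conjTranspose_mul 1
  have hcomm : U * hardCoreLatticeGas d L lam = hardCoreLatticeGas d L lam * U := by
    have h := quarterTurn_conj_hardCoreLatticeGas d L lam
    have h2 := congrArg (· * U) h
    simp only at h2
    rw [mul_assoc, hUU, mul_one] at h2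
    exact h2
  have hinv := Matrix.gibbsState_conj_of_commute hcomm hUU β (siteSpin 1 x 1 * siteSpin 1 y 1)
  rw [productOp_conj_mul (fun _ => spinPhase_conjTranspose_mul 1),
    quarterTurn_conj_siteSpin_one, quarterTurn_conj_siteSpin_one] at hinv
  rw [hinv]

/-! ### (Tᵀ) `|⟨Sᵅ_x Sᵅ_y⟩| ≤ ¼` -/

/-- **Discharge of (Tᵀ)** `hc_corr_abs_le`: `|Re ⟨Sᵅ_xSᵅ_y⟩_β| ≤ ¼` (`¼ ∓ Sᵅ_xSᵅ_y ≥ 0` for spin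
½, and the Gibbs state is positive and normalised for every real `β`). [folklore] -/
theorem hc_corr_abs_le_holds : hc_corr_abs_le := by
  intro α d L β lam x y
  rcases Nat.eq_zero_or_pos L with rfl | hL
  · simp only [hcCorr_zero_side, abs_zero]
    positivity
  haveI : NeZero L := ⟨hL.ne'⟩
  rw [hcCorr_of_neZero, thermalCorr]
  set H := hardCoreLatticeGas d L lam with hH
  have hHerm : H.IsHermitian := hardCoreLatticeGas_isHermitian d L lam
  have hone : gibbsState β H 1 = 1 := gibbsState_one β H (partitionFn_pos β hHerm).ne'
  have hup := gibbsState_nonneg_of_posSemidef β hHerm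
    (posSemidef_sq_smul_one_sub_siteSpin_mul' 1 x y α)
  rw [map_sub, LinearMap.map_smul, hone, smul_eq_mul, mul_one] at hup
  obtain ⟨hup_re, -⟩ := Complex.nonneg_iff.mp hup
  rw [Complex.sub_re, re_half_sq] at hup_re
  have hlo := gibbsState_nonneg_of_posSemidef β hHerm
    (posSemidef_sq_smul_one_add_siteSpin_mul' 1 x y α)
  rw [map_add, LinearMap.map_smul, hone, smul_eq_mul, mul_one] at hlo
  obtain ⟨hlo_re, -⟩ := Complex.nonneg_iff.mp hlo
  rw [Complex.add_re, re_half_sq] at hlo_re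
  rw [abs_le]
  norm_num at hup_re hlo_re ⊢
  constructor <;> linarith

/-! ### (Cᵀ) The sum rule -/

/-- The thermal two-point function is symmetric: `G^α(x,y) = G^α(y,x)` (`⟨(S_xS_y)ᴴ⟩ = conj
⟨S_xS_y⟩` for the Hermitian Gibbs state, and `(S_xS_y)ᴴ = S_yS_x`). [folklore] -/
theorem hcCorr_symm (α : Fin 3) (β : ℝ) (L : ℕ) (lam : ℝ) (x y : TorusSite d L) :
    hcCorr α β L lam x y = hcCorr α β L lam y x := by
  rcases Nat.eq_zero_or_pos L with rfl | hL
  · simp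
  haveI : NeZero L := ⟨hL.ne'⟩
  rw [hcCorr_of_neZero, hcCorr_of_neZero, thermalCorr, thermalCorr]
  have h : siteSpin 1 y α * siteSpin 1 x α = (siteSpin 1 x α * siteSpin 1 y α)ᴴ := by
    rw [conjTranspose_mul, (siteSpin_isHermitian 1 x α).eq, (siteSpin_isHermitian 1 y α).eq]
  rw [h, gibbsState_conjTranspose β (hardCoreLatticeGas_isHermitian d L lam), Complex.star_def,
    Complex.conj_re]

/-- **Discharge of (Cᵀ)** `hc_sumRule`: the finite-volume sum rule
`|Λ|⁻¹ Σ_q ĝ^α_q (d⁻¹ Σᵢ cos qᵢ) = e_α` ([KLS1988PRL] eqs. (3), (6)) for the thermal structure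
factor, by the tree's character identity `sum_structureFactor_mul_cos` and `hcCorr_symm`.
[cite: KLS1988PRL, eq. (6)] -/
theorem hc_sumRule_holds : hc_sumRule := by
  intro d hd α L _ β lam hL
  have hd0 : (d : ℝ) ≠ 0 := by exact_mod_cast (show d ≠ 0 by omega)
  have hL0 : (L : ℝ) ^ d ≠ 0 := by
    have : (L : ℝ) ≠ 0 := by exact_mod_cast NeZero.ne L
    positivity
  simp_rw [hcStructureFactor_of_neZero, torusCosSum, hcBondCorr_of_neZero]
  have h : ∀ q : TorusSite d L,
      (∑ x : TorusSite d L, ∑ y : TorusSite d L,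
          Real.cos (torusPhase L q (x - y)) * hcCorr α β L lam x y) / (L : ℝ) ^ d *
        ((∑ i : Fin d, Real.cos (latticeMomentum L q i)) / d) =
      (∑ i : Fin d, (∑ x : TorusSite d L, ∑ y : TorusSite d L,
          Real.cos (torusPhase L q (x - y)) * hcCorr α β L lam x y) *
        Real.cos (latticeMomentum L q i)) / ((d : ℝ) * (L : ℝ) ^ d) := by
    intro q
    rw [div_mul_div_comm, mul_sum, mul_comm ((L : ℝ) ^ d) (d : ℝ)]
  simp_rw [h]
  rw [← sum_div, sum_comm]
  simp_rw [sum_structureFactor_mul_cos L (hcCorr α β L lam) (hcCorr_symm α β L lam)]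
  rw [← mul_sum, sum_comm]
  field_simp

end Literature.Barriers.AtomisticToContinuum.BoseGas
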